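import Literature.MathematicalPhysics.QuantumFieldTheory.ConformalBootstrap3D.DoPochHalfFactor
import Literature.MathematicalPhysics.QuantumFieldTheory.ConformalBootstrap3D.HRCoeffABBoundTables
import HarnessLib

/-!
# `Δ`-cell enclosures of the Pochhammer ratio `ρ(a) = P(a)/P(0)` of the mixed-block coefficients

The rank-one structure `A_{n,j}(a,b) = A_{n,j}(0,0) ρ(a) ρ(b)` of Dolan–Osborn's `z`-series
coefficients (`DoPochHalfFactor.hrCoeffAB_eq_hrCoeff_mul_doPochRatio`, eq. (3.11)) turns the level-`(n,j)`
coefficient matrix of a `2 × 2` sector of a mixed sum rule into `A_{n,j}(0,0)` times a congruence by the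
weights `ρ(a_i)`.  A finite certificate on a CELL `Δ ∈ [E₁, E₂]` (external dimensions in a box, so
`a ∈ [a₁, a₂]`) needs TWO-SIDED rational enclosures of these weights.  In product form
`ρ(a) = ∏_{i<m} (X+i+a)/(X+i) · ∏_{i<n'} (x+i+a)/(x+i)`, `X = (Δ+ℓ)/2`, `x = (Δ−ℓ−1)/2`
(`doPochRatio_eq_ratioProd_mul`; unconditional with Lean's `x/0 = 0`), every factor `(y+a)/y = 1 + a/y`
is enclosed on a `y`-interval off zero by corner values (`ratioFac_mem_Icc`, from the tree's
`div_mem_corners`), and products by plain interval multiplication (`mul_mem_Icc_ivMul`).  Result: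
`doPochRatio_mem_Icc_cell` — `ρ(a)(Δ) ∈ [ρLo, ρHi]` (`doPochRatioIv a₁ a₂ E₁ E₂ ℓ n j`) for
`E₁ ≤ Δ ≤ E₂`, `a₁ ≤ a ≤ a₂`, `0 < E₁ + ℓ`, provided no factor `x + i`, `i < n'`, changes sign on the
cell (`ℓ ≥ 1`: automatic above the bound; `ℓ = 0`: the cell must not contain `Δ = 1`).  When all factors
have a determinate sign the per-factor corners are attained at a common corner of the cell, so the tables
are then the exact corner values; in general they are a sound outer enclosure.  Finite rational
computations for rational data; no numerics here.

USE (planning note, O(2) three-scalar scan): the cell rules of the charged `2 × 2` sectors `2⁺`, `1`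
(`O2ChargeTwoEvenTermwise`, `O2ChargeOneTermwise`) consume these enclosures for
`a ∈ {±(Δ_t−Δ_s)/2, ±(Δ_t−Δ_φ)/2, ±(Δ_φ−Δ_s)/2}`.  DECLARATIONS: `ivMulLo`, `ivMulHi`, `ratioFacLo`,
`ratioFacHi`, `ratioProd`, `ratioProdIv`, `doPochRatioIv` (definitions).

References: Dolan–Osborn, Nucl. Phys. B 678 (2004) 491, §3 eq. (3.11) (`DolanOsborn2004`);
Moore, *Methods and Applications of Interval Analysis* (SIAM 1979), §2.2 eqs. (2.18)–(2.19), the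
endpoint formula of the interval product (`Moore1979`).
-/

noncomputable section

namespace Literature.MathematicalPhysics.QuantumFieldTheory.ConformalBootstrap3D

open Finset Set

/-! ### §1 The interval product -/

/-- Lower end of the interval product `[l₁,h₁]·[l₂,h₂]`: the least of the four corner products.
[cite: Moore1979, §2.2 eqs. (2.18)–(2.19)] -/
def ivMulLo (l₁ h₁ l₂ h₂ : ℝ) : ℝ :=
  min (min (l₁ * l₂) (l₁ * h₂)) (min (h₁ * l₂) (h₁ * h₂))

/-- Upper end of the interval product `[l₁,h₁]·[l₂,h₂]`: the greatest of the four corner products.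
[cite: Moore1979, §2.2 eqs. (2.18)–(2.19)] -/
def ivMulHi (l₁ h₁ l₂ h₂ : ℝ) : ℝ :=
  max (max (l₁ * l₂) (l₁ * h₂)) (max (h₁ * l₂) (h₁ * h₂))

/-- `c·y` lies between `c·l` and `c·h` for `y ∈ [l,h]`, whatever the sign of `c`.
[cite: Moore1979, §2.2 eqs. (2.18)–(2.19)] -/
theorem const_mul_mem_corners {c l y h : ℝ} (h1 : l ≤ y) (h2 : y ≤ h) :
    min (c * l) (c * h) ≤ c * y ∧ c * y ≤ max (c * l) (c * h) := by
  rcases le_total 0 c with hc | hc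
  · exact ⟨(min_le_left _ _).trans (mul_le_mul_of_nonneg_left h1 hc),
      (mul_le_mul_of_nonneg_left h2 hc).trans (le_max_right _ _)⟩
  · exact ⟨(min_le_right _ _).trans (mul_le_mul_of_nonpos_left h2 hc),
      (mul_le_mul_of_nonpos_left h1 hc).trans (le_max_left _ _)⟩

/-- **Interval product**: `x ∈ [l₁,h₁]`, `y ∈ [l₂,h₂]` ⇒ `x·y ∈ [ivMulLo, ivMulHi]`.
[cite: Moore1979, §2.2 eqs. (2.18)–(2.19)] -/
theorem mul_mem_Icc_ivMul {l₁ x h₁ l₂ y h₂ : ℝ} (hx : x ∈ Icc l₁ h₁) (hy : y ∈ Icc l₂ h₂) :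
    x * y ∈ Icc (ivMulLo l₁ h₁ l₂ h₂) (ivMulHi l₁ h₁ l₂ h₂) := by
  obtain ⟨k₁l, k₁h⟩ := const_mul_mem_corners (c := l₁) hy.1 hy.2
  obtain ⟨k₂l, k₂h⟩ := const_mul_mem_corners (c := h₁) hy.1 hy.2
  obtain ⟨k₃l, k₃h⟩ := const_mul_mem_corners (c := y) hx.1 hx.2
  rw [mul_comm y l₁, mul_comm y h₁, mul_comm y x] at k₃l k₃h
  refine ⟨?_, ?_⟩
  · have e : ivMulLo l₁ h₁ l₂ h₂ ≤ min (l₁ * y) (h₁ * y) :=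
      le_min ((min_le_left _ _).trans k₁l) ((min_le_right _ _).trans k₂l)
    exact e.trans k₃l
  · have e : max (l₁ * y) (h₁ * y) ≤ ivMulHi l₁ h₁ l₂ h₂ :=
      max_le (k₁h.trans (le_max_left _ _)) (k₂h.trans (le_max_right _ _))
    exact k₃h.trans e

/-! ### §2 One ratio factor `(y+a)/y` on a `y`-interval off zero -/

/-- Lower corner value of `(y+a)/y = 1 + a/y` over `y ∈ [y_lo, y_hi]` (off zero), `a ∈ [a₁, a₂]`:
`1 + min(a₁/y_lo, a₁/y_hi)` if `y_lo > 0`, `1 + min(a₂/y_hi, a₂/y_lo)` if `y_hi < 0`.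
[cite: DolanOsborn2004, §3 eq. (3.11)] [cite: Moore1979, §2.2 eqs. (2.18)–(2.19)] -/
def ratioFacLo (ylo yhi a₁ a₂ : ℝ) : ℝ :=
  if 0 < ylo then 1 + min (a₁ / ylo) (a₁ / yhi) else 1 + min (a₂ / yhi) (a₂ / ylo)

/-- Upper corner value of `(y+a)/y` over `y ∈ [y_lo, y_hi]` (off zero), `a ∈ [a₁, a₂]`.
[cite: DolanOsborn2004, §3 eq. (3.11)] [cite: Moore1979, §2.2 eqs. (2.18)–(2.19)] -/
def ratioFacHi (ylo yhi a₁ a₂ : ℝ) : ℝ :=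
  if 0 < ylo then 1 + max (a₂ / ylo) (a₂ / yhi) else 1 + max (a₁ / yhi) (a₁ / ylo)

/-- **Enclosure of one factor**: `(y+a)/y ∈ [ratioFacLo, ratioFacHi]` for `y ∈ [y_lo, y_hi]` with
`y_lo > 0` or `y_hi < 0`, `a ∈ [a₁, a₂]`. [cite: DolanOsborn2004, §3 eq. (3.11)]
[cite: Moore1979, §2.2 eqs. (2.18)–(2.19)] -/
theorem ratioFac_mem_Icc {ylo y yhi a₁ a a₂ : ℝ} (hsep : 0 < ylo ∨ yhi < 0) (h1 : ylo ≤ y) (h2 : y ≤ yhi)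
    (ha1 : a₁ ≤ a) (ha2 : a ≤ a₂) :
    (y + a) / y ∈ Icc (ratioFacLo ylo yhi a₁ a₂) (ratioFacHi ylo yhi a₁ a₂) := by
  rcases hsep with hpos | hneg
  · have hy : 0 < y := hpos.trans_le h1
    rw [ratioFacLo, ratioFacHi, if_pos hpos, if_pos hpos, add_div, div_self hy.ne']
    obtain ⟨hlo, hhi⟩ := div_mem_corners hpos h1 h2 ha1 ha2
    exact ⟨by linarith, by linarith⟩
  · have hy : y < 0 := h2.trans_lt hneg
    have hnot : ¬ 0 < ylo := not_lt.mpr (h1.trans hy.le)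
    rw [ratioFacLo, ratioFacHi, if_neg hnot, if_neg hnot, add_div, div_self hy.ne]
    obtain ⟨hlo, hhi⟩ := div_mem_corners (ylo := -yhi) (y := -y) (yhi := -ylo) (c₁ := -a₂) (c := -a)
      (c₂ := -a₁) (by linarith) (by linarith) (by linarith) (by linarith) (by linarith)
    simp only [neg_div_neg_eq] at hlo hhi
    exact ⟨by linarith, by linarith⟩

/-! ### §3 Products of ratio factors -/

/-- `∏_{i<K} (y₀+i+a)/(y₀+i)` — one Pochhammer ratio `(y₀+a)_K/(y₀)_K`. [cite: DolanOsborn2004, §3 eq. (3.11)] -/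
def ratioProd (y₀ a : ℝ) (K : ℕ) : ℝ :=
  ∏ i ∈ range K, ((y₀ + i + a) / (y₀ + i))

/-- The enclosure table of `ratioProd y₀ a K` for `y₀ ∈ [y_lo, y_hi]`, `a ∈ [a₁, a₂]` (pair `(lo, hi)`),
folded factor by factor with the interval product. [cite: DolanOsborn2004, §3 eq. (3.11)]
[cite: Moore1979, §2.2 eqs. (2.18)–(2.19)] -/
def ratioProdIv (ylo yhi a₁ a₂ : ℝ) : ℕ → ℝ × ℝ
  | 0 => (1, 1)
  | K + 1 =>
      (ivMulLo (ratioProdIv ylo yhi a₁ a₂ K).1 (ratioProdIv ylo yhi a₁ a₂ K).2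
          (ratioFacLo (ylo + K) (yhi + K) a₁ a₂) (ratioFacHi (ylo + K) (yhi + K) a₁ a₂),
        ivMulHi (ratioProdIv ylo yhi a₁ a₂ K).1 (ratioProdIv ylo yhi a₁ a₂ K).2
          (ratioFacLo (ylo + K) (yhi + K) a₁ a₂) (ratioFacHi (ylo + K) (yhi + K) a₁ a₂))

/-- `ratioProd` with one more factor. Bookkeeping. [cite: DolanOsborn2004, §3 eq. (3.11)] -/
theorem ratioProd_succ (y₀ a : ℝ) (K : ℕ) :
    ratioProd y₀ a (K + 1) = ratioProd y₀ a K * ((y₀ + K + a) / (y₀ + K)) := by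
  simp only [ratioProd, Finset.prod_range_succ]

/-- **Enclosure of a ratio product**: if no factor interval `[y_lo+i, y_hi+i]`, `i < K`, contains zero, then
`ratioProd y₀ a K ∈ [lo, hi]` (`ratioProdIv`) for `y₀ ∈ [y_lo, y_hi]`, `a ∈ [a₁, a₂]`.
[cite: DolanOsborn2004, §3 eq. (3.11)] [cite: Moore1979, §2.2 eqs. (2.18)–(2.19)] -/
theorem ratioProd_mem_Icc {ylo y₀ yhi a₁ a a₂ : ℝ} (h1 : ylo ≤ y₀) (h2 : y₀ ≤ yhi) (ha1 : a₁ ≤ a)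
    (ha2 : a ≤ a₂) :
    ∀ K : ℕ, (∀ i : ℕ, i < K → 0 < ylo + i ∨ yhi + i < 0) →
      ratioProd y₀ a K ∈ Icc (ratioProdIv ylo yhi a₁ a₂ K).1 (ratioProdIv ylo yhi a₁ a₂ K).2
  | 0, _ => by simp [ratioProd, ratioProdIv]
  | K + 1, hsep => by
      have ih := ratioProd_mem_Icc h1 h2 ha1 ha2 K fun i hi => hsep i (Nat.lt_succ_of_lt hi)
      have hf := ratioFac_mem_Icc (ylo := ylo + K) (y := y₀ + K) (yhi := yhi + K) (hsep K K.lt_succ_self)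
        (by linarith) (by linarith) ha1 ha2
      rw [ratioProd_succ]
      exact mul_mem_Icc_ivMul ih hf

/-! ### §4 `ρ(a)` in product form and its cell enclosure -/

/-- **`ρ(a) = ∏_{i<m} (X+i+a)/(X+i) · ∏_{i<n'} (x+i+a)/(x+i)`**, `X = (Δ+ℓ)/2`, `x = (Δ−ℓ−1)/2`
(unconditionally, with Lean's `x/0 = 0` on both sides). [cite: DolanOsborn2004, §3 eq. (3.11)] -/
theorem doPochRatio_eq_ratioProd_mul (a Δ : ℝ) (ℓ n j : ℕ) :
    doPochRatio a Δ ℓ n j =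
      ratioProd ((Δ + ℓ) / 2) a (doIndexM ℓ n j) * ratioProd ((Δ - ℓ - 1) / 2) a (doIndexN ℓ n j) := by
  simp only [doPochRatio, doPochHalf, ratioProd, add_zero, Finset.prod_div_distrib, div_mul_div_comm]

/-- The cell enclosure table of `ρ(a)(Δ; ℓ, n, j)` for `Δ ∈ [E₁, E₂]`, `a ∈ [a₁, a₂]` (pair `(lo, hi)`).
[cite: DolanOsborn2004, §3 eq. (3.11)] [cite: Moore1979, §2.2 eqs. (2.18)–(2.19)] -/
def doPochRatioIv (a₁ a₂ E₁ E₂ : ℝ) (ℓ n j : ℕ) : ℝ × ℝ :=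
  (ivMulLo (ratioProdIv ((E₁ + ℓ) / 2) ((E₂ + ℓ) / 2) a₁ a₂ (doIndexM ℓ n j)).1
      (ratioProdIv ((E₁ + ℓ) / 2) ((E₂ + ℓ) / 2) a₁ a₂ (doIndexM ℓ n j)).2
      (ratioProdIv ((E₁ - ℓ - 1) / 2) ((E₂ - ℓ - 1) / 2) a₁ a₂ (doIndexN ℓ n j)).1
      (ratioProdIv ((E₁ - ℓ - 1) / 2) ((E₂ - ℓ - 1) / 2) a₁ a₂ (doIndexN ℓ n j)).2,
    ivMulHi (ratioProdIv ((E₁ + ℓ) / 2) ((E₂ + ℓ) / 2) a₁ a₂ (doIndexM ℓ n j)).1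
      (ratioProdIv ((E₁ + ℓ) / 2) ((E₂ + ℓ) / 2) a₁ a₂ (doIndexM ℓ n j)).2
      (ratioProdIv ((E₁ - ℓ - 1) / 2) ((E₂ - ℓ - 1) / 2) a₁ a₂ (doIndexN ℓ n j)).1
      (ratioProdIv ((E₁ - ℓ - 1) / 2) ((E₂ - ℓ - 1) / 2) a₁ a₂ (doIndexN ℓ n j)).2)

/-- **Cell enclosure of `ρ(a)`**: for `E₁ ≤ Δ ≤ E₂` with `0 < E₁ + ℓ`, `a₁ ≤ a ≤ a₂`, and no sign change of
a factor `(Δ−ℓ−1)/2 + i`, `i < n'`, on the cell, `ρ(a)(Δ; ℓ, n, j) ∈ [lo, hi]` (`doPochRatioIv`).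
For `ℓ ≥ 1` and `E₁ > ℓ + 1` the separation hypothesis holds with the left alternative; for `ℓ = 0` it
asks that the cell avoid `Δ = 1`. [cite: DolanOsborn2004, §3 eq. (3.11)]
[cite: Moore1979, §2.2 eqs. (2.18)–(2.19)] -/
theorem doPochRatio_mem_Icc_cell {a₁ a a₂ E₁ Δ E₂ : ℝ} {ℓ n j : ℕ} (hE : 0 < E₁ + ℓ) (h1 : E₁ ≤ Δ)
    (h2 : Δ ≤ E₂) (ha1 : a₁ ≤ a) (ha2 : a ≤ a₂)
    (hsep : ∀ i : ℕ, i < doIndexN ℓ n j →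
      0 < (E₁ - ℓ - 1) / 2 + i ∨ (E₂ - ℓ - 1) / 2 + i < 0) :
    doPochRatio a Δ ℓ n j ∈ Icc (doPochRatioIv a₁ a₂ E₁ E₂ ℓ n j).1 (doPochRatioIv a₁ a₂ E₁ E₂ ℓ n j).2 := by
  have hX := ratioProd_mem_Icc (ylo := (E₁ + ℓ) / 2) (y₀ := (Δ + ℓ) / 2) (yhi := (E₂ + ℓ) / 2)
    (by linarith) (by linarith) ha1 ha2 (doIndexM ℓ n j)
    (fun i _ => Or.inl (by positivity))
  have hx := ratioProd_mem_Icc (ylo := (E₁ - ℓ - 1) / 2) (y₀ := (Δ - ℓ - 1) / 2) (yhi := (E₂ - ℓ - 1) / 2)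
    (by linarith) (by linarith) ha1 ha2 (doIndexN ℓ n j) hsep
  rw [doPochRatio_eq_ratioProd_mul]
  exact mul_mem_Icc_ivMul hX hx

/-- The separation hypothesis above the line `Δ = ℓ + 1`: if `ℓ + 1 < E₁` every factor
`(Δ−ℓ−1)/2 + i` is positive on the cell. [cite: DolanOsborn2004, §3 eq. (3.11)] -/
theorem sep_of_lt {E₁ E₂ : ℝ} {ℓ : ℕ} (hE : (ℓ : ℝ) + 1 < E₁) (K : ℕ) :
    ∀ i : ℕ, i < K → 0 < (E₁ - ℓ - 1) / 2 + i ∨ (E₂ - ℓ - 1) / 2 + i < 0 :=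
  fun i _ => Or.inl (by have : (0 : ℝ) ≤ i := Nat.cast_nonneg i; linarith)

/-- **Cell enclosure of `ρ(a)` above the line `Δ = ℓ + 1`** (the generic case: `ℓ ≥ 1` anywhere above the
unitarity bound, or `ℓ = 0` with `Δ > 1`). [cite: DolanOsborn2004, §3 eq. (3.11)]
[cite: Moore1979, §2.2 eqs. (2.18)–(2.19)] -/
theorem doPochRatio_mem_Icc_cell_of_lt {a₁ a a₂ E₁ Δ E₂ : ℝ} {ℓ n j : ℕ} (hE : (ℓ : ℝ) + 1 < E₁)
    (h1 : E₁ ≤ Δ) (h2 : Δ ≤ E₂) (ha1 : a₁ ≤ a) (ha2 : a ≤ a₂) :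
    doPochRatio a Δ ℓ n j ∈ Icc (doPochRatioIv a₁ a₂ E₁ E₂ ℓ n j).1 (doPochRatioIv a₁ a₂ E₁ E₂ ℓ n j).2 :=
  doPochRatio_mem_Icc_cell (by have : (0 : ℝ) ≤ ℓ := Nat.cast_nonneg ℓ; linarith) h1 h2 ha1 ha2
    (sep_of_lt (E₂ := E₂) hE _)

/-! ### §5 Products and squares of two weights -/

/-- **Enclosure of a product of two weights** `ρ(a)ρ(b)` on a cell from the two enclosures (interval
product). [cite: DolanOsborn2004, §3 eq. (3.11)] [cite: Moore1979, §2.2 eqs. (2.18)–(2.19)] -/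
theorem doPochRatio_mul_mem_Icc {a b Δ : ℝ} {ℓ n j : ℕ} {la ha lb hb : ℝ}
    (hA : doPochRatio a Δ ℓ n j ∈ Icc la ha) (hB : doPochRatio b Δ ℓ n j ∈ Icc lb hb) :
    doPochRatio a Δ ℓ n j * doPochRatio b Δ ℓ n j ∈ Icc (ivMulLo la ha lb hb) (ivMulHi la ha lb hb) :=
  mul_mem_Icc_ivMul hA hB

/-- **Enclosure of a squared weight** `ρ(a)²` on a cell: `[sqLower lo hi, sqUpper lo hi]` (tree).
[cite: DolanOsborn2004, §3 eq. (3.11)] [cite: Moore1979, §2.2 eqs. (2.18)–(2.19)] -/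
theorem doPochRatio_sq_mem_Icc {a Δ : ℝ} {ℓ n j : ℕ} {lo hi : ℝ} (hA : doPochRatio a Δ ℓ n j ∈ Icc lo hi) :
    doPochRatio a Δ ℓ n j ^ 2 ∈ Icc (sqLower lo hi) (sqUpper lo hi) :=
  ⟨sqLower_le_sq hA.1 hA.2, sq_le_sqUpper hA.1 hA.2⟩

end Literature.MathematicalPhysics.QuantumFieldTheory.ConformalBootstrap3D

end
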